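import Mathlib

/-!
# T5GenericTriples — the choice condition ID-C1 of T5-ID §ID-2(c) (pub-hodge-repro2, seat p2)

Step ID-2(c) of `route/T5-ID-p2.md` (Tier 5, sub-step N1) handles the non-primitive vertex
`c = 010` through one of two alternatives (CHOICE CONDITION ID-C1):

* (three-φ variant) when `d(μ_c, K) = dim_ℚ Hom_E(A_K, A_{μ_c}) ≥ 3`, three ℚ-linearly
  independent morphisms `φ_c^{(1)}, φ_c^{(2)}, φ_c^{(3)}` exist, and «the independent triples are
  Zariski-dense in Hom³»: the dependent triples lie in the zero locus of a polynomial in the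
  coordinates which is not identically zero;
* (diagonal variant) `f_c^*e_{c,τ₁} = (Σ_j λ_j) · alb^* φ_c^* p_c′^* ê` is non-zero iff `Σ_j λ_j ≠ 0`.

Kernel-checked here in the abstract, for a vector space `V` over a field `K` with a basis `b`
indexed by `ι` (the ℚ-space `Hom_E(A_K, A_{μ_c})_ℚ` of ID-2(c)):

* `exists_linearIndependent_fin3` : `3 ≤ finrank K V → ∃ v : Fin 3 → V, LinearIndependent K v`;
* `minor b e v` : the 3×3 minor `det (b.repr (v j) (e i))_{i,j}` of the coordinate matrix of the
  triple `v` on the rows `e : Fin 3 → ι`;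
* `minor_eq_eval_detPoly` : the minor is the evaluation, at the coordinates of `v`, of the fixed
  polynomial `detPoly K = det (X_{ij})` in nine variables — so it IS a polynomial function of `v`;
* `minor_eq_zero_of_not_linearIndependent` : a linearly dependent triple has every minor `= 0`
  (the dependent triples lie in the zero locus);
* `minor_basis_triple`, `detPoly_ne_zero` : on the basis triple `v j = b (e j)` the minor is `1`,
  so the polynomial is not identically zero (the zero locus is a proper Zariski-closed subset);
* `smul_sum_ne_zero_iff` : `(Σ_j λ_j) • u ≠ 0 ↔ Σ_j λ_j ≠ 0` for `u ≠ 0` (the diagonal variant).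
-/

namespace Summit.Ventures.HodgeRepro2.T5GenericTriples

open Module

variable {K V : Type*} [Field K] [AddCommGroup V] [Module K V]

/-- ID-C1, three-φ variant, existence: a space of dimension `≥ 3` contains a linearly independent
triple (three ℚ-linearly independent morphisms `φ_c^{(j)}` when `d(μ_c, K) ≥ 3`). -/
theorem exists_linearIndependent_fin3 [FiniteDimensional K V] (h : 3 ≤ finrank K V) :
    ∃ v : Fin 3 → V, LinearIndependent K v :=
  ⟨fun j => finBasis K V (Fin.castLE h j),
    (finBasis K V).linearIndependent.comp _ (Fin.castLE_injective h)⟩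

variable {ι : Type*}

/-- The 3×3 minor of the coordinate matrix of a triple `v` in the basis `b`, on the rows `e`:
`det (b.repr (v j) (e i))_{i j}`. -/
noncomputable def minor (b : Basis ι K V) (e : Fin 3 → ι) (v : Fin 3 → V) : K :=
  Matrix.det (Matrix.of fun i j => b.repr (v j) (e i))

/-- The fixed polynomial `det (X_{ij})_{i,j ∈ Fin 3}` in the nine variables `X_{ij}`. -/
noncomputable def detPoly (K : Type*) [Field K] : MvPolynomial (Fin 3 × Fin 3) K :=
  Matrix.det (Matrix.of fun i j : Fin 3 => MvPolynomial.X (i, j))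

/-- The minor is a polynomial function of the coordinates of the triple: it is the evaluation of
`detPoly K` at the coordinate matrix `(i, j) ↦ b.repr (v j) (e i)`. -/
theorem minor_eq_eval_detPoly (b : Basis ι K V) (e : Fin 3 → ι) (v : Fin 3 → V) :
    minor b e v = MvPolynomial.eval (fun p : Fin 3 × Fin 3 => b.repr (v p.2) (e p.1)) (detPoly K) := by
  unfold minor detPoly
  rw [RingHom.map_det]
  congr 1
  ext i j
  simp [RingHom.mapMatrix_apply, Matrix.map_apply]

/-- A linearly dependent triple has every 3×3 minor equal to `0`: the dependent triples lie in the
zero locus of `minor b e` (a column relation `Σ_j c_j v_j = 0`, `c ≠ 0`, is a non-trivial kernel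
vector of the coordinate matrix). -/
theorem minor_eq_zero_of_not_linearIndependent (b : Basis ι K V) (e : Fin 3 → ι)
    {v : Fin 3 → V} (hv : ¬ LinearIndependent K v) : minor b e v = 0 := by
  obtain ⟨c, hc, i₀, hi₀⟩ := Fintype.not_linearIndependent_iff.mp hv
  refine Matrix.exists_mulVec_eq_zero_iff.mp ⟨c, fun h => hi₀ (congrFun h i₀), ?_⟩
  funext i
  have h1 : (b.repr (∑ j, c j • v j)) (e i) = 0 := by rw [hc]; simp
  have h2 : (b.repr (∑ j, c j • v j)) (e i) = ∑ j, b.repr (v j) (e i) * c j := by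
    simp only [map_sum, map_smul, Finsupp.finsetSum_apply, Finsupp.smul_apply, smul_eq_mul]
    exact Finset.sum_congr rfl fun j _ => mul_comm _ _
  simp only [Matrix.mulVec, Matrix.of_apply, dotProduct, Pi.zero_apply]
  rw [← h2, h1]

/-- On the basis triple `v j = b (e j)` (with `e` injective) the minor is `1`. -/
theorem minor_basis_triple (b : Basis ι K V) {e : Fin 3 → ι} (he : Function.Injective e) :
    minor b e (fun j => b (e j)) = 1 := by
  have h : (Matrix.of fun i j => b.repr (b (e j)) (e i)) = (1 : Matrix (Fin 3) (Fin 3) K) := by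
    ext i j
    by_cases hij : i = j
    · subst hij; simp [Basis.repr_self]
    · have : e j ≠ e i := fun h' => hij (he h').symm
      simp [Basis.repr_self, this, hij]
  unfold minor
  rw [h, Matrix.det_one]

/-- The polynomial `detPoly K` is not identically zero (its value at the identity matrix is `1`),
so the zero locus of the minor is a proper Zariski-closed subset and the linearly independent
triples are Zariski-dense once one exists. -/
theorem detPoly_ne_zero : detPoly K ≠ 0 := by
  intro h
  have h1 : MvPolynomial.eval (fun p : Fin 3 × Fin 3 => (1 : Matrix (Fin 3) (Fin 3) K) p.1 p.2)
      (detPoly K) = 1 := by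
    unfold detPoly
    rw [RingHom.map_det]
    have : (MvPolynomial.eval fun p : Fin 3 × Fin 3 => (1 : Matrix (Fin 3) (Fin 3) K) p.1 p.2).mapMatrix
        (Matrix.of fun i j : Fin 3 => MvPolynomial.X (i, j)) = (1 : Matrix (Fin 3) (Fin 3) K) := by
      ext i j
      simp [RingHom.mapMatrix_apply, Matrix.map_apply]
    rw [this, Matrix.det_one]
  rw [h, map_zero] at h1
  exact zero_ne_one h1

/-- ID-C1, diagonal variant: `(Σ_j λ_j) • u ≠ 0 ↔ Σ_j λ_j ≠ 0` for a non-zero `u`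
(`f_c^*e_{c,τ₁} = (Σ_j λ_j) · alb^* φ_c^* p_c′^* ê`). -/
theorem smul_sum_ne_zero_iff {n : Type*} [Fintype n] (lam : n → K) {u : V} (hu : u ≠ 0) :
    (∑ j, lam j) • u ≠ 0 ↔ ∑ j, lam j ≠ 0 := by
  rw [Ne, smul_eq_zero, not_or]
  exact ⟨fun h => h.1, fun h => ⟨h, hu⟩⟩

end Summit.Ventures.HodgeRepro2.T5GenericTriples
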